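import Literature.Analysis.FluidPDE.DEIJCriterion
import Summits.AnomalousDissipation.AnomalousDissipation.Theorems.LimitingAbsorptionKinematicSteadySourceLawToolkit
import HarnessLib

/-!
# Negative knowledge for the crux `RelaxingFamily` (stmt-AnomalousDissipation-15009), 0: global weak
# scalars for locally bounded drifts

Tool file for the refuted strengthenings of
`Summit.AnomalousDissipation.AnomalousDissipation.Theses.LimitingAbsorption.RelaxingFamily` (supports
stmt-AnomalousDissipation-15009). The obstruction-side fact `Literature.Analysis.FluidPDE.Seis2022_rmk1_L2`
(proved in the tree) is stated for ONE weak scalar solving `∂ₜθ + u·∇θ = κΔθ`, `θ(0) = θ₀` on `[0,T)` for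
EVERY `T > 0`, whereas the crux quantifies over the solutions on each horizon separately and the tree's
existence theorem (`Torus.exists_isWeakScalarTransportOn_of_sq`, `Torus.IsGlobalLerayHopf.exists_release`)
is per horizon. This file closes the gap for drifts that are essentially bounded on every `(0,T) × T^d`
(the crux's local-boundedness clause), where weak solutions are unique
(`KinematicSteadySourceLaw.ae_eq_of_memLp_top`):

* `isWeakScalarTransportOn_congr_ae_slice` — the weak class is stable under modification of the scalar on
  a null set of time slices (all its scalar-side conjuncts are slice-wise a.e. statements or iterated
  integrals), given space–time measurability of the new field;
* `exists_global_isWeakScalarTransportOn` — **gluing**: from solutions `ϑₙ` on the horizons `n + 1`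
  the field `θ(t) := ϑ_{⌊t⌋}(t)` is a weak solution on every `[0,T)` (it agrees slice-wise a.e. with
  `ϑ_{⌈T⌉}` on `(0,T)` by uniqueness, and is space–time measurable strip by strip).

## References

* R. J. DiPerna, P.-L. Lions, Invent. Math. 98 (1989), §II.1 (the weak class). [`DiPernaLions1989`]
* T. Drivas, T. Elgindi, G. Iyer, I.-J. Jeong, ARMA 243 (2022), (1.3) (energy/uniqueness for bounded
  drift). [`DEIJ2022`]
-/

noncomputable section

open MeasureTheory Set Filter Function TopologicalSpace
open scoped ENNReal NNReal InnerProductSpace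

namespace Summit.AnomalousDissipation.AnomalousDissipation.Theorems.RelaxingFamily.Negative

-- D-0017: single-problem summit ⇒ `Summit.AnomalousDissipation.AnomalousDissipation.…` by design.
set_option linter.dupNamespace false

open Literature.Analysis Literature.Analysis.FluidPDE Literature.Analysis.FluidPDE.Torus

variable {d : Type*} [Fintype d]

/-! ## Modification on a null set of slices -/

section CongrAE

variable {T κ : ℝ} {u : ℝ → UnitAddTorus d → EuclideanSpace ℝ d} {θ₀ : UnitAddTorus d → ℝ}
  {θ θ' : ℝ → UnitAddTorus d → ℝ}

/-- **The weak class is stable under a.e.-slice modification.** If `θ'` is a weak solution on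
`[0,T)`, `θ` is space–time measurable on `(0,T) × T^d` and `θ(t) = θ'(t)` a.e. on `T^d` for a.e.
`t ∈ (0,T)`, then `θ` is a weak solution on `[0,T)` with the same drift and datum (every scalar-side
conjunct of `Torus.IsWeakScalarTransportOn` is an a.e.-in-time statement about, or an iterated integral
of, the slices). [folklore] -/
theorem isWeakScalarTransportOn_congr_ae_slice (h : IsWeakScalarTransportOn T κ u θ₀ θ')
    (hm : AEStronglyMeasurable (FunctionSpaces.Torus.stLift θ) (volume.restrict (Ioo 0 T ×ˢ univ)))
    (hae : ∀ᵐ t ∂(volume.restrict (Ioo 0 T)), θ t =ᵐ[volume] θ' t) :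
    IsWeakScalarTransportOn T κ u θ₀ θ where
  aestronglyMeasurable := hm
  aestronglyMeasurable_velocity := h.aestronglyMeasurable_velocity
  ae_lintegral_sq_le := by
    obtain ⟨C, hC⟩ := h.ae_lintegral_sq_le
    refine ⟨C, ?_⟩
    filter_upwards [hC, hae] with t ht hte
    calc ∫⁻ x, ‖θ t x‖ₑ ^ 2 = ∫⁻ x, ‖θ' t x‖ₑ ^ 2 :=
          lintegral_congr_ae (hte.mono fun x hx => by beta_reduce; rw [hx])
      _ ≤ C := ht
  lintegral_velocity_lt_top := h.lintegral_velocity_lt_top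
  lintegral_mul_lt_top := by
    calc ∫⁻ t in Ioo 0 T, ∫⁻ x, ‖u t x‖ₑ * ‖θ t x‖ₑ
          = ∫⁻ t in Ioo 0 T, ∫⁻ x, ‖u t x‖ₑ * ‖θ' t x‖ₑ :=
          lintegral_congr_ae (hae.mono fun t hte => lintegral_congr_ae (hte.mono fun x hx => by beta_reduce; rw [hx]))
      _ < ⊤ := h.lintegral_mul_lt_top
  ae_isWeaklyDivFree := h.ae_isWeaklyDivFree
  weak_eq ψ hψ := by
    have e : (∫ t in Ioo 0 T, ∫ x, θ t x *
        (FunctionSpaces.Torus.timeDeriv ψ t x + ⟪u t x, FunctionSpaces.Torus.gradient (ψ t) x⟫_ℝ +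
          κ * FunctionSpaces.Torus.laplacian (ψ t) x)) =
        ∫ t in Ioo 0 T, ∫ x, θ' t x *
        (FunctionSpaces.Torus.timeDeriv ψ t x + ⟪u t x, FunctionSpaces.Torus.gradient (ψ t) x⟫_ℝ +
          κ * FunctionSpaces.Torus.laplacian (ψ t) x) :=
      integral_congr_ae (hae.mono fun t hte => integral_congr_ae (hte.mono fun x hx => by beta_reduce; rw [hx]))
    rw [e]
    exact h.weak_eq ψ hψ

end CongrAE

/-! ## Gluing per-horizon solutions into a global one -/

section Glue

variable {κ : ℝ} {u : ℝ → UnitAddTorus d → EuclideanSpace ℝ d} {θ₀ : UnitAddTorus d → ℝ}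

/-- **Global weak scalars from per-horizon ones (bounded drift).** Let `κ > 0` and let the drift
`u` be essentially bounded on `(0,T) × T^d` for every `T > 0`. If for every `T > 0` the problem
`∂ₜθ + u·∇θ = κΔθ`, `θ(0) = θ₀` has a weak solution on `[0,T)`, then it has ONE weak solution on
`[0,T)` for all `T > 0` simultaneously: with `ϑₙ` a solution on `[0, n+1)`, the glued field
`θ(t) := ϑ_{⌊t⌋}(t)` agrees with `ϑ_N` (`N = ⌈T⌉`) for a.e. slice `t ∈ (0,T)` by uniqueness for bounded
drift (`KinematicSteadySourceLaw.ae_eq_of_memLp_top`), hence solves on `[0,T)`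
(`isWeakScalarTransportOn_congr_ae_slice`). [folklore] -/
theorem exists_global_isWeakScalarTransportOn (hκ : 0 < κ)
    (hu : ∀ T : ℝ, 0 < T →
      MemLp (FunctionSpaces.Torus.stLift u) ∞ (volume.restrict (Ioo 0 T ×ˢ univ)))
    (hex : ∀ T : ℝ, 0 < T → ∃ θ : ℝ → UnitAddTorus d → ℝ, IsWeakScalarTransportOn T κ u θ₀ θ) :
    ∃ θ : ℝ → UnitAddTorus d → ℝ, ∀ T : ℝ, 0 < T → IsWeakScalarTransportOn T κ u θ₀ θ := by
  have hn : ∀ n : ℕ, (0 : ℝ) < n + 1 := fun n => by positivity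
  choose ϑ hϑ using fun n : ℕ => hex ((n : ℝ) + 1) (hn n)
  refine ⟨fun t => ϑ ⌊t⌋₊ t, fun T hT => ?_⟩
  set N : ℕ := ⌈T⌉₊ with hN
  have hTN : T ≤ (N : ℝ) + 1 := (Nat.le_ceil T).trans (le_add_of_nonneg_right zero_le_one)
  have hsolN : IsWeakScalarTransportOn T κ u θ₀ (ϑ N) := (hϑ N).of_le hTN
  refine isWeakScalarTransportOn_congr_ae_slice hsolN ?_ ?_
  · -- space–time measurability, strip by strip
    set μ : Measure (ℝ × EuclideanSpace ℝ d) := volume.restrict (Ioo 0 T ×ˢ univ) with hμ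
    let s : ℕ → Set (ℝ × EuclideanSpace ℝ d) := fun n => {p | ⌊p.1⌋₊ = n}
    have hs : ∀ n, MeasurableSet (s n) := fun n =>
      (Nat.measurable_floor.comp measurable_fst) (measurableSet_singleton n)
    have hU : (⋃ n, s n) = univ := by
      ext p
      simp only [mem_iUnion, mem_setOf_eq, mem_univ, iff_true, s]
      exact ⟨_, rfl⟩
    have key : ∀ n, AEStronglyMeasurable (FunctionSpaces.Torus.stLift fun t => ϑ ⌊t⌋₊ t)
        (μ.restrict (s n)) := by
      intro n
      have hsub : (s n ∩ Ioo 0 T ×ˢ (univ : Set (EuclideanSpace ℝ d))) ⊆ Ioo 0 ((n : ℝ) + 1) ×ˢ univ := by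
        rintro ⟨t, y⟩ ⟨hts, hty⟩
        refine ⟨⟨(mem_prod.1 hty).1.1, ?_⟩, mem_univ _⟩
        have : ⌊t⌋₊ = n := hts
        rw [← this]
        exact Nat.lt_floor_add_one t
      have hle : μ.restrict (s n) ≤ volume.restrict (Ioo 0 ((n : ℝ) + 1) ×ˢ univ) := by
        rw [hμ, Measure.restrict_restrict (hs n)]
        exact Measure.restrict_mono hsub le_rfl
      have h1 : AEStronglyMeasurable (FunctionSpaces.Torus.stLift (ϑ n)) (μ.restrict (s n)) :=
        (hϑ n).aestronglyMeasurable.mono_measure hle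
      refine h1.congr ?_
      have hmem : ∀ᵐ p ∂(μ.restrict (s n)), p ∈ s n := ae_restrict_mem (hs n)
      filter_upwards [hmem] with p hp
      obtain ⟨t, y⟩ := p
      have : ⌊t⌋₊ = n := hp
      simp only [FunctionSpaces.Torus.stLift_apply, this]
    have := (aestronglyMeasurable_iUnion_iff (μ := μ) (s := s)).2 key
    rwa [hU, Measure.restrict_univ] at this
  · -- a.e. slice: `ϑ_{⌊t⌋} (t) = ϑ_N (t)` for a.e. `t ∈ (0,T)`
    have hall : ∀ n : ℕ, ∀ᵐ t ∂(volume.restrict (Ioo 0 T)),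
        ⌊t⌋₊ = n → ϑ n t =ᵐ[volume] ϑ N t := by
      intro n
      rcases le_or_gt n N with hnN | hnN
      · have hle : (n : ℝ) + 1 ≤ (N : ℝ) + 1 := by exact_mod_cast Nat.succ_le_succ hnN
        have huniq := KinematicSteadySourceLaw.ae_eq_of_memLp_top hκ (hϑ n) ((hϑ N).of_le hle)
          (hu _ (hn n))
        rw [ae_restrict_iff' measurableSet_Ioo] at huniq ⊢
        filter_upwards [huniq] with t ht htT hfl
        refine ht ⟨htT.1, ?_⟩
        rw [← hfl]
        exact Nat.lt_floor_add_one t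
      · rw [ae_restrict_iff' measurableSet_Ioo]
        refine Eventually.of_forall fun t htT hfl => absurd hfl (ne_of_lt ?_)
        calc ⌊t⌋₊ ≤ ⌊T⌋₊ := Nat.floor_le_floor htT.2.le
          _ ≤ ⌈T⌉₊ := Nat.floor_le_ceil T
          _ < n := hnN
    have hall' := ae_all_iff.2 hall
    filter_upwards [hall'] with t ht
    exact ht ⌊t⌋₊ rfl

end Glue

end Summit.AnomalousDissipation.AnomalousDissipation.Theorems.RelaxingFamily.Negative

end
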